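import Literature.NumberTheory.EllipticCurves.Sprung2012.ColemanOrbitLayerTwoProofs
import HarnessLib

/-!
# Sprung 2012 §§2, 5, 7: the `Λ`-orbit of the Prop. 7.3 functional MODULO `p` on the layer `E(K_2·K_v)` —
# `p² − p + 1` layer functionals independent modulo `p` from the Coleman map alone (proofs only; roadmap step (R2a))

Topic `Literature/NumberTheory/EllipticCurves`, cluster `Sprung2012` (namespace = path). A THEOREMS file (no definition, no named
fact; net Literature debt `0`). Cell `bsd-ssimc`, width seat `cruxlead-stmt-BirchSwinnertonDyer-19875-w2` (gen 8), `--supports`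
stmt-BirchSwinnertonDyer-22569. Continues `Sprung2012/ColemanOrbitLayerTwoProofs.lean` ((R1): the `Λ`-orbit of `z₀` is `Λ/ω_2` on the
layer) towards the hypothesis of `exists_linearMap_isColemanPair_cokernel_of_indep_rat` (`HondaOrbitRankOfFunctionalsProofs.lean`:
`p²` functionals `E(ℚ_{p,2}) →+ ℤ_p` independent MODULO `p`). F. E. I. Sprung, *Iwasawa theory for elliptic curves at supersingular primes:
A pair of main conjectures*, J. Number Theory **132** (2012) [Sprung2012], Def. 5.9 / 7.1–7.2 with Sprung 2017 Cor. 4.4 (`u_2 = a_p`,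
`v_2 = −Φ_p(1+T)`), in the tree's functional model.

* **`natCast_dvd_coeff_of_dvd_lambdaSMul_apply`** — for `z₀` with Coleman value `(α, β)`, `β(0) ∈ ℤ_p^×`, `p ∣ a_p`: if `f • z₀` is
  divisible by `p` pointwise on `E(K_2·K_v)`, then **`p ∣ f_j` for all `j < p² − p + 1`** (level `2` of Def. 5.9 reduced modulo `p`:
  `T^{p²} ∣ f̄·T^{p−1}·β̄` in `𝔽_p⟦T⟧`).
* **`natCast_dvd_of_sum_lambdaSMul_X_pow_dvd`** — hence the `p² − p + 1` layer functionals `(T^t • z₀)|_{E(K_2·K_v)}`, `t < p² − p + 1`,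
  are INDEPENDENT MODULO `p`; `exists_functional_sum_lambdaSMul_X_pow_indep` — over `ℚ` at an odd good supersingular prime with the
  functional of the proof of Prop. 7.3 (`exists_isColemanPair_isUnit`).
HONEST FRAMING: this is `p² − p + 1` of the `p²` directions; the bound is sharp for the `Λ`-orbit (`(T^{p²−p+1} • z₀)|₂ ∈ p·Hom`),
and the remaining `p − 1` directions are `((T^{p²−p+1} • z₀)|₂)/p` and its `g`-translates, available through the saturation clause
of `IsHondaSystem` — roadmap (R2b–c) in `Cruxes/SprungLowerDivisibilityAtThree/Lines/chromatic-common-zeros-COKER-w2g8.md`. Nothing about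
any Selmer group, main conjecture or BSD is asserted.

References: [Sprung2012] Thm. 2.2 / Lemma 2.3 (p. 1487), Def. 3.1 (p. 1489), Def. 5.9 (p. 1495), Def. 7.1–7.2, Prop. 7.3 (p. 1500), Lemma
7.10 (p. 1503); [Sprung2017] §4 Cor. 4.4; [Pollack2003] Thm. 6.17; tree `Sprung2012/{ColemanOrbitLayerTwoProofs, ColemanMapSurjectiveProofs,
ColemanMapLevelCongruenceProofs, LocalIwasawaModule}.lean`.
-/

noncomputable section

open scoped Classical

open Polynomial Finset

namespace Literature.NumberTheory.EllipticCurves.Sprung2012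

open Literature.NumberTheory.EllipticCurves Literature.NumberTheory.GaloisRepresentations ZpExtension
  Literature.NumberTheory.EllipticCurves.Kobayashi2003 Literature.NumberTheory.EllipticCurves.Sprung2017

/-! ## §0 Reductions modulo `p` in `Λ` (plumbing) -/

section ModP

variable {p : ℕ} [Fact p.Prime]

/-- Reduction modulo `p` commutes with `ℤ[X] → Λ`. [folklore] -/
private theorem map_toZMod_toIwasawa' (q : ℤ[X]) :
    PowerSeries.map (PadicInt.toZMod (p := p)) (toIwasawa p q) = ((q.map (Int.castRingHom (ZMod p)) : (ZMod p)[X]) :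
      PowerSeries (ZMod p)) := by
  ext n
  rw [PowerSeries.coeff_map, show toIwasawa p q = ((q.map (Int.castRingHom ℤ_[p]) : ℤ_[p][X]) : PowerSeries ℤ_[p]) from rfl,
    Polynomial.coeff_coe, Polynomial.coeff_coe, Polynomial.coeff_map, Polynomial.coeff_map, eq_intCast, eq_intCast,
    map_intCast]

/-- `ω_n ≡ T^{pⁿ} (mod p)`. [cite: Pollack2003, Thm. 6.17 (ω_n)] -/
private theorem map_toZMod_toIwasawa_cyclotomicOmega' (n : ℕ) :
    PowerSeries.map (PadicInt.toZMod (p := p)) (toIwasawa p (cyclotomicOmega p n)) = PowerSeries.X ^ p ^ n := by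
  rw [map_toZMod_toIwasawa', cyclotomicOmega, Polynomial.map_sub, Polynomial.map_pow, Polynomial.map_add,
    Polynomial.map_X, Polynomial.map_one, add_pow_char_pow, one_pow, add_sub_cancel_right, Polynomial.coe_pow,
    Polynomial.coe_X]

/-- `Φ_p(1+T) ≡ T^{p−1} (mod p)` (`ω_1 = T·Φ_p(1+T)`). [cite: Pollack2003, Thm. 6.17 (ω_n)] -/
private theorem map_toZMod_toIwasawa_cyclotomic_comp_one :
    PowerSeries.map (PadicInt.toZMod (p := p)) (toIwasawa p ((cyclotomic p ℤ).comp (X + 1))) = PowerSeries.X ^ (p - 1) := by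
  have hp : p.Prime := Fact.out
  have h := congrArg (PowerSeries.map (PadicInt.toZMod (p := p))) (toIwasawa_cyclotomicOmega_one (p := p))
  rw [map_mul, map_toZMod_toIwasawa_cyclotomicOmega', PowerSeries.map_X, pow_one,
    show (PowerSeries.X : PowerSeries (ZMod p)) ^ p = PowerSeries.X * PowerSeries.X ^ (p - 1) by
      rw [← pow_succ', Nat.sub_add_cancel hp.one_le]] at h
  exact (mul_left_cancel₀ PowerSeries.X_ne_zero h).symm

/-- `p ∣ x ↔ toZMod x = 0` in `ℤ_p`. [folklore] -/
private theorem padicInt_dvd_iff_toZMod_eq_zero'' (x : ℤ_[p]) : (p : ℤ_[p]) ∣ x ↔ PadicInt.toZMod x = 0 := by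
  rw [← RingHom.mem_ker, PadicInt.ker_toZMod, PadicInt.maximalIdeal_eq_span_p, Ideal.mem_span_singleton]

end ModP

/-! ## §1 `f • z₀ ≡ 0 (mod p)` on the layer forces `f ∈ (p, T^{p²−p+1})` -/

section Local

universe u

variable {K : Type u} [Field K] {p : ℕ} [Fact p.Prime] (κ : ZpExtension K p)
variable {E : Type u} [Field E] [Algebra K E] (ι : AlgebraicClosure K →ₐ[K] AlgebraicClosure E)
variable (W : WeierstrassCurve K)

variable {κ ι W}

/-- **The `Λ`-orbit of a functional with unit flat constant term has at least `p² − p + 1` independent directions modulo `p`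
on `E(K_2·K_v)`.** For `z₀` with Coleman value `(α, β)`, `β(0) ∈ ℤ_p^×` (`p ∣ a_p`, Honda levels): if `f • z₀` is divisible by `p`
POINTWISE on the layer `E(K_2·K_v)`, then `p ∣ f_j` for every coefficient `f_j`, `j < p² − p + 1`, of `f`. Level `2` of Def. 5.9 for
`Col(f•z₀) = (fα, fβ)` reads `P_{2,c_2}(f•z₀) + a_p fα − Φ_p(1+T) fβ ∈ ω_2Λ` with `P_{2,c_2}(f•z₀) ∈ pΛ`; modulo `p`
(`a_p ≡ 0`, `Φ_p(1+T) ≡ T^{p−1}`, `ω_2 ≡ T^{p²}`): `T^{p²} ∣ f̄·T^{p−1}·β̄`, i.e. `T^{p²−p+1} ∣ f̄`.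
[cite: Sprung2012, Def. 5.9 (p. 1495), Def. 7.1–7.2 (p. 1500), Lemma 7.10 (p. 1503)] [cite: Sprung2017, §4 Cor. 4.4] -/
theorem natCast_dvd_coeff_of_dvd_lambdaSMul_apply {ap : ℤ} (hap : (p : ℤ) ∣ ap) {g : Field.absoluteGaloisGroup E}
    (hg : κ.IsTopGenerator (resGalOfEmb ι g)) {c : ℕ → localPoints W E} (hc : ∀ n, c n ∈ localLayerPointsOfEmb κ ι W n)
    {z₀ : localTowerPointsOfEmb κ ι W →+ ℤ_[p]} {α β : IwasawaAlgebra p} (h₀ : IsColemanPair κ ι W ap g c z₀ α β)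
    (hβ : IsUnit (PowerSeries.constantCoeff β)) (f : IwasawaAlgebra p)
    (hf : ∀ (x : localPoints W E) (hx : x ∈ localLayerPointsOfEmb κ ι W 2),
      (p : ℤ_[p]) ∣ lambdaSMul κ ι W hg f z₀ ⟨x, localLayerPointsOfEmb_le_localTowerPointsOfEmb κ ι W 2 hx⟩)
    {j : ℕ} (hj : j < p ^ 2 - p + 1) : (p : ℤ_[p]) ∣ PowerSeries.coeff j f := by
  have hp : p.Prime := Fact.out
  have hfz := isColemanPair_lambdaSMul hg hc h₀ f
  -- the pairing sum at `c_2` is divisible by `p`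
  choose a ha using fun jj : ℕ ↦ hf (g ^ jj • c 2) (smul_mem_localLayerPointsOfEmb κ ι W 2 _ (hc 2))
  have hP : pairingSum W (localTowerPointsOfEmb κ ι W) g 2 (c 2) (lambdaSMul κ ι W hg f z₀) =
      PowerSeries.C (p : ℤ_[p]) * ∑ jj ∈ range (p ^ 2), PowerSeries.C (a jj) * (1 + PowerSeries.X) ^ jj := by
    rw [pairingSum_def, mul_sum]
    refine sum_congr rfl fun jj _ ↦ ?_
    rw [evalOn_of_mem W _ _ (localLayerPointsOfEmb_le_localTowerPointsOfEmb κ ι W 2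
      (smul_mem_localLayerPointsOfEmb κ ι W 2 _ (hc 2))), ha jj, map_mul, mul_assoc]
  -- level 2 of the Coleman characterisation
  obtain ⟨Q, hQ⟩ := hfz 2
  rw [sharpPoly_two, flatPoly_two, pow_one, map_neg, hP,
    show toIwasawa p (C ap) = PowerSeries.C (ap : ℤ_[p]) by
      rw [show toIwasawa p (C ap) = (((C ap : ℤ[X]).map (Int.castRingHom ℤ_[p]) : ℤ_[p][X]) : PowerSeries ℤ_[p]) from rfl,
        Polynomial.map_C, eq_intCast, Polynomial.coe_C]] at hQ
  -- reduce modulo `p`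
  have h := congrArg (PowerSeries.map (PadicInt.toZMod (p := p))) hQ
  obtain ⟨b, hb⟩ := hap
  rw [map_mul, map_toZMod_toIwasawa_cyclotomicOmega', map_add, map_mul, PowerSeries.map_C, map_natCast,
    ZMod.natCast_self, map_zero, zero_mul, zero_add, map_add, map_mul, map_mul, PowerSeries.map_C, hb, Int.cast_mul,
    Int.cast_natCast, map_mul, map_natCast, ZMod.natCast_self, zero_mul, map_zero, zero_mul, zero_add, neg_mul, map_neg,
    map_mul, map_toZMod_toIwasawa_cyclotomic_comp_one, map_mul] at h
  -- `h : -(X^(p-1) * (f̄ * β̄)) = X^(p^2) * Q̄`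
  have hβu : IsUnit (PowerSeries.map (PadicInt.toZMod (p := p)) β) := by
    rw [PowerSeries.isUnit_iff_constantCoeff, ← PowerSeries.coeff_zero_eq_constantCoeff_apply, PowerSeries.coeff_map,
      PowerSeries.coeff_zero_eq_constantCoeff_apply]
    exact hβ.map _
  have hdvd : (PowerSeries.X : PowerSeries (ZMod p)) ^ (p ^ 2 - p + 1) ∣ PowerSeries.map (PadicInt.toZMod (p := p)) f := by
    have h1 : (PowerSeries.X : PowerSeries (ZMod p)) ^ (p - 1) * (PowerSeries.X ^ (p ^ 2 - p + 1)) ∣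
        PowerSeries.X ^ (p - 1) * (PowerSeries.map (PadicInt.toZMod (p := p)) f * PowerSeries.map (PadicInt.toZMod (p := p)) β) := by
      have e : (PowerSeries.X : PowerSeries (ZMod p)) ^ (p - 1) * PowerSeries.X ^ (p ^ 2 - p + 1) = PowerSeries.X ^ (p ^ 2) := by
        rw [← pow_add]
        congr 1
        have h2 : p ≤ p ^ 2 := by rw [sq]; exact Nat.le_mul_self p
        have := hp.one_le
        omega
      rw [e, ← dvd_neg, h]
      exact dvd_mul_right _ _
    have h2 := (mul_dvd_mul_iff_left (pow_ne_zero _ PowerSeries.X_ne_zero)).mp h1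
    exact (hβu.dvd_mul_right).mp h2
  rw [PowerSeries.X_pow_dvd_iff] at hdvd
  rw [padicInt_dvd_iff_toZMod_eq_zero'', ← PowerSeries.coeff_map]
  exact hdvd j hj

/-- `Λ`-linearity of `lambdaSMul` over finite sums (plumbing). [cite: Sprung2012, Def. 5.9 (p. 1495)] -/
private theorem lambdaSMul_finset_sum {g : Field.absoluteGaloisGroup E} (hg : κ.IsTopGenerator (resGalOfEmb ι g))
    {ι' : Type*} (s : Finset ι') (F : ι' → IwasawaAlgebra p) (z : localTowerPointsOfEmb κ ι W →+ ℤ_[p]) :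
    lambdaSMul κ ι W hg (∑ t ∈ s, F t) z = ∑ t ∈ s, lambdaSMul κ ι W hg (F t) z := by
  induction s using Finset.induction_on with
  | empty => rw [sum_empty, sum_empty, zero_lambdaSMul]
  | insert a s ha ih => rw [sum_insert ha, sum_insert ha, add_lambdaSMul, ih]

/-- **`p² − p + 1` layer functionals independent modulo `p`, from the Coleman map alone**: for `z₀` as above, the functionals
`u_t := (T^t • z₀)|_{E(K_2·K_v)}`, `t < p² − p + 1`, satisfy: `∑_t λ_t u_t ≡ 0 (mod p)` pointwise ⟹ `p ∣ λ_t` for all `t` — the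
first `p² − p + 1` of the `p²` directions asked for by `exists_linearMap_isColemanPair_cokernel_of_indep_rat`.
[cite: Sprung2012, Def. 5.9 (p. 1495), Def. 7.1–7.2 (p. 1500), Thm. 2.2 / Lemma 2.3 (p. 1487)] -/
theorem natCast_dvd_of_sum_lambdaSMul_X_pow_dvd {ap : ℤ} (hap : (p : ℤ) ∣ ap) {g : Field.absoluteGaloisGroup E}
    (hg : κ.IsTopGenerator (resGalOfEmb ι g)) {c : ℕ → localPoints W E} (hc : ∀ n, c n ∈ localLayerPointsOfEmb κ ι W n)
    {z₀ : localTowerPointsOfEmb κ ι W →+ ℤ_[p]} {α β : IwasawaAlgebra p} (h₀ : IsColemanPair κ ι W ap g c z₀ α β)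
    (hβ : IsUnit (PowerSeries.constantCoeff β)) (cf : Fin (p ^ 2 - p + 1) → ℤ_[p])
    (hcf : ∀ (x : localPoints W E) (hx : x ∈ localLayerPointsOfEmb κ ι W 2),
      (p : ℤ_[p]) ∣ ∑ t, cf t * lambdaSMul κ ι W hg ((PowerSeries.X : IwasawaAlgebra p) ^ (t : ℕ)) z₀
        ⟨x, localLayerPointsOfEmb_le_localTowerPointsOfEmb κ ι W 2 hx⟩) (t : Fin (p ^ 2 - p + 1)) :
    (p : ℤ_[p]) ∣ cf t := by
  set f : IwasawaAlgebra p := ∑ s : Fin (p ^ 2 - p + 1), PowerSeries.C (cf s) * PowerSeries.X ^ (s : ℕ) with hfdef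
  have hcoeff : PowerSeries.coeff (t : ℕ) f = cf t := by
    rw [hfdef, map_sum, sum_eq_single t]
    · rw [PowerSeries.coeff_C_mul_X_pow, if_pos rfl]
    · intro s _ hst
      rw [PowerSeries.coeff_C_mul_X_pow, if_neg (fun h ↦ hst (Fin.ext h).symm)]
    · intro h; exact absurd (mem_univ t) h
  rw [← hcoeff]
  refine natCast_dvd_coeff_of_dvd_lambdaSMul_apply hap hg hc h₀ hβ f (fun x hx ↦ ?_) t.2
  rw [hfdef, lambdaSMul_finset_sum, AddMonoidHom.finsetSum_apply]
  refine (hcf x hx).trans (Finset.sum_congr rfl fun s _ ↦ ?_).symm.dvd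
  rw [mul_lambdaSMul, lambdaSMul_C, AddMonoidHom.smul_apply, smul_eq_mul]

end Local

/-! ## §2 Over `ℚ`: the functional of Prop. 7.3 -/

section Rat

open NumberField IsDedekindDomain

/-- **Over `ℚ` at an odd good supersingular prime, `Hom(E(ℚ_{p,2}), ℤ_p)` contains `p² − p + 1` functionals independent modulo `p`
built from the Coleman map**: `(T^t • z₀)|_{E(ℚ_{p,2})}`, `t < p² − p + 1`, for the functional `z₀` of the proof of Prop. 7.3.
(The full `p²` needed by `exists_linearMap_isColemanPair_cokernel_of_indep_rat` requires `p − 1` more from the saturation clause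
of `IsHondaSystem` — roadmap (R2) in the crux directory.) [cite: Sprung2012, proof of Prop. 7.3 (p. 1500), Def. 5.9 (p. 1495), Lemma 2.3 (p. 1487)] -/
theorem exists_functional_sum_lambdaSMul_X_pow_indep (W : WeierstrassCurve ℚ) [W.IsElliptic] [W.IsGloballyMinimal]
    (p : ℕ) [Fact p.Prime] (hp2 : p ≠ 2) (hgood : W.HasGoodReductionAtPrime p) (hap : (p : ℤ) ∣ W.frobeniusTrace p)
    (κ : ZpExtension ℚ p) {v : HeightOneSpectrum (𝓞 ℚ)} (hpv : (p : 𝓞 ℚ) ∈ v.asIdeal)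
    {g : Field.absoluteGaloisGroup (v.adicCompletion ℚ)}
    (hg : κ.IsTopGenerator (resGalOfEmb (closureEmb (K := ℚ) (v.adicCompletion ℚ)) g))
    {cneg : localPoints W (v.adicCompletion ℚ)} {c : ℕ → localPoints W (v.adicCompletion ℚ)}
    (hH : IsHondaSystem κ (closureEmb (K := ℚ) (v.adicCompletion ℚ)) W (W.frobeniusTrace p) g cneg c) :
    ∃ z₀ : localTowerPointsOfEmb κ (closureEmb (K := ℚ) (v.adicCompletion ℚ)) W →+ ℤ_[p],
      ∀ cf : Fin (p ^ 2 - p + 1) → ℤ_[p],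
        (∀ (x : localPoints W (v.adicCompletion ℚ))
            (hx : x ∈ localLayerPointsOfEmb κ (closureEmb (K := ℚ) (v.adicCompletion ℚ)) W 2),
            (p : ℤ_[p]) ∣ ∑ t, cf t * lambdaSMul κ (closureEmb (K := ℚ) (v.adicCompletion ℚ)) W hg
              ((PowerSeries.X : IwasawaAlgebra p) ^ (t : ℕ)) z₀ ⟨x, localLayerPointsOfEmb_le_localTowerPointsOfEmb κ _ W 2 hx⟩) →
          ∀ t, (p : ℤ_[p]) ∣ cf t := by
  obtain ⟨z₀, Ls, Lf, hCP, -, hLf⟩ := exists_isColemanPair_isUnit W p hp2 hgood hap κ hpv _ hg hH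
  exact ⟨z₀, fun cf hcf t ↦ natCast_dvd_of_sum_lambdaSMul_X_pow_dvd hap hg hH.2.1 hCP
    (PowerSeries.isUnit_iff_constantCoeff.mp hLf) cf hcf t⟩

end Rat

end Literature.NumberTheory.EllipticCurves.Sprung2012

end
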